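import Literature.NumberTheory.EllipticCurves.ModularCurveSturmProofs
import Literature.NumberTheory.EllipticCurves.HeckeOperatorsProofs
import Mathlib.NumberTheory.ModularForms.Discriminant
import HarnessLib

/-!
# The multiplier of `η²`, `η`-products of weight `2`, and `dim S₂(Γ₀(N)) = g(X₀(N)) = 1`
  for `N = 11, 20, 27, 32, 36`
  (trunk EllArithM, item C17; five genus-one instances of the named fact
  `finrank_cuspForm_two_eq_genusX0`)

`ModularCurveSturmProofs` proves `dim S₂(Γ₀(N)) ≤ 1 = g(X₀(N))` for the genus-one levels
`N ∈ {11, 14, 15, 20, 24, 27, 32, 36}` by the cuspidal Sturm bound. This file constructs a nonzero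
element of `S₂(Γ₀(N))` for the five of them carried by an `η²`-product,

  `φ₁₁ = η(τ)²η(11τ)²`, `φ₂₀ = η(2τ)²η(10τ)²`, `φ₂₇ = η(3τ)²η(9τ)²`, `φ₃₂ = η(4τ)²η(8τ)²`,
  `φ₃₆ = η(6τ)⁴`

(`cuspFormEtaProductEleven`, …, `cuspFormEtaProductThirtySix`), and concludes
**`dim_ℂ S₂(Γ₀(N)) = 1 = g(X₀(N))`**, i.e. the fact `finrank_cuspForm_two_eq_genusX0 N`, for
`N = 11, 20, 27, 32, 36` (`finrank_cuspForm_two_eq_genusX0_eleven`, …), together with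
`S₂(Γ₀(N)) = ℂφ_N`. For `N = 11` this is Diamond–Shurman Prop. 3.2.2 (`(k, N) = (2, 11)`), where
`S₂(Γ₀(11)) ⊆ ℂφ₁₁` is proved and `φ₁₁ ∈ S₂(Γ₀(11))` is taken from the dimension formula — the
input not available here. Membership is proved directly, uniformly in `N`, from:

* **The multiplier system of `η²` in closed form** (`etaSq_slash_SL2`): for every
  `γ = (a b; c d) ∈ SL₂(ℤ)`,
    `η² |₁ γ = e^{πi e(γ)/6} η²`, `e(γ) ≡ (1 - c²)(bd + 3(c - 1)d + c + 3) + c(a + d - 3) (mod 12)`,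
  a character of order `12` of `SL₂(ℤ)` factoring through `SL₂(ℤ/12ℤ)`. Proof: `η²|₁T = ζη²`,
  `ζ = e^{πi/6}` (from the product; `etaSq_slash_T`) and `η²|₁S = -iη²` (from Mathlib's
  `η(-1/z) = (√i)⁻¹√z η(z)`, `eta_comp_eq_csqrt_I_inv`; `etaSq_slash_S`); then induction over
  words in `S, T` (`SL₂(ℤ) = ⟨S, T⟩`, Mathlib), the step congruences `e(γT) ≡ e(γ) + 1`,
  `e(γS) ≡ e(γ) + 9 (mod 12)` being finite checks on `(ℤ/4ℤ)⁴` and `(ℤ/3ℤ)⁴` (`decide`).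
* **Translates of `η(aτ)² = η²|₁D_a`**, `D_a = diag(a, 1)` (the matrix `tpD a` of
  `HeckeOperatorsProofs`, reused with its API `val_tpD`, `det_tpD`, `slash_tpD_apply`):
  under `γ ∈ SL₂(ℤ)` with `a ∣ c` they
  transform like `η²` under `D_aγD_a⁻¹ = (a, ab; c/a, d)` (`etaSq_slash_tpD_slash`), and for
  *every* `γ ∈ SL₂(ℤ)`, `(η²|₁D_a)|₁γ → 0` at `∞` (`isZeroAtImInfty_etaSq_slash_tpD_slash`):
  `D_aγ = γ'M` with `γ' ∈ SL₂(ℤ)`, `M = (g m; 0 a/g)` (`g = gcd(aγ₀₀, γ₁₀)`, Bezout), so the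
  translate is a root of unity times `η((gτ + m)g/a)² · g/a`, which decays because
  `|η|²⁴ = |Δ|` and `Δ` is a cusp form (`tendsto_eta_sq_affine`). Thus `η`-products vanish at all
  cusps without locating the cusps.
* **Invariance**: for `γ = (p q; Nk s) ∈ Γ₀(N)`, `φ_N|₂γ = e^{πi(e(γ_a) + e(γ_b))/6}φ_N`, and
  `e(γ_a) + e(γ_b) ≡ 0 (mod 12)` is again a finite check modulo `4` and `3` in the residues of
  `p, q, k, s` (`twelve_dvd_etaProduct…_exp`, `decide`). (For `η(τ)²η(14τ)²`, not a form on
  `Γ₀(14)`, the check fails, as it must.)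

Then `φ_N ≠ 0`, so `1 ≤ dim S₂(Γ₀(N)) ≤ 1`.

General helpers proved along the way (for reuse): `csqrt_sq` (`(√z)² = z` for Mathlib's
`Complex.sqrt`, which so far only has `csqrt_pow_24_eq`), `eta_add_one`
(`η(z + 1) = e^{2πi/24}η(z)`), `tendsto_eta_sq_affine`, `isZeroAtImInfty_slash_T_pow`,
`mdifferentiable_etaSq`.

## References

* F. Diamond, J. Shurman, *A first course in modular forms*, GTM 228, Springer (2005):
  §1.2 (`η`, `Δ`), Prop. 3.2.2 (`φ_k = η^kη(N·)^k`, `k(N + 1) = 24`), Thm. 3.5.1 and Figure 3.3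
  (`g(X₀(N)) = 1` for these `N`).
-/

/-! ### `η²` under `T` and `S` -/

noncomputable section

open UpperHalfPlane hiding I
open ModularForm Complex Matrix.SpecialLinearGroup Filter Asymptotics CongruenceSubgroup
open scoped MatrixGroups Real ModularForm CongruenceSubgroup Topology Manifold

namespace Literature.NumberTheory.EllipticCurves.ModularForms

/-- `η(τ)²`, the square of the Dedekind eta function, as a function on `ℍ`. [folklore] -/
def etaSq (τ : ℍ) : ℂ := η τ ^ 2

/-- `etaSq τ = η(τ)²`. [folklore] -/
theorem etaSq_apply (τ : ℍ) : etaSq τ = η τ ^ 2 := rfl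

/-- `η(τ)² ≠ 0` on `ℍ` (Mathlib `eta_ne_zero`). [folklore] -/
theorem etaSq_ne_zero (τ : ℍ) : etaSq τ ≠ 0 := pow_ne_zero _ (eta_ne_zero τ.2)

/-- `η(z + 1) = e^{2πi/24} η(z)`. [folklore] -/
theorem eta_add_one (z : ℂ) : η (z + 1) = cexp (2 * π * I / 24) * η z := by
  simp only [ModularForm.eta]
  have hq : ∀ n : ℕ, eta_q n (z + 1) = eta_q n z := fun n ↦ by
    rw [eta_q_eq_cexp, eta_q_eq_cexp, mul_add, Complex.exp_add, mul_one]
    have : cexp (2 * π * I * (n + 1)) = 1 := by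
      rw [show (2 * π * I * (n + 1) : ℂ) = (n + 1 : ℕ) * (2 * π * I) by push_cast; ring,
        Complex.exp_nat_mul_two_pi_mul_I]
    rw [this, mul_one]
  simp only [hq]
  rw [← mul_assoc]
  congr 1
  simp only [Function.Periodic.qParam]
  rw [← Complex.exp_add]
  congr 1
  push_cast
  ring

/-- `η² |₁ T = e^{πi/6} η²`. [folklore] -/
theorem etaSq_slash_T : etaSq ∣[(1 : ℤ)] ModularGroup.T = cexp (π * I / 6) • etaSq := by
  ext τ
  rw [SL_slash_apply, denom, modular_T_smul]
  simp only [Pi.smul_apply, smul_eq_mul, etaSq, ModularGroup.T]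
  rw [coe_vadd, ofReal_one, add_comm, eta_add_one]
  simp
  rw [mul_pow, ← Complex.exp_nat_mul]
  congr 1
  congr 1
  ring

/-- `(√z)² = z` for Mathlib's principal square root `Complex.sqrt z = z ^ (1/2)`. [folklore] -/
theorem csqrt_sq (z : ℂ) : Complex.sqrt z ^ 2 = z := by
  rw [Complex.sqrt, show (2⁻¹ : ℂ) = ((2 : ℕ) : ℂ)⁻¹ by norm_num,
    Complex.cpow_nat_inv_pow _ two_ne_zero]

/-- `η² |₁ S = -i η²`, from `η(-1/z) = (√i)⁻¹ √z η(z)` (Mathlib `eta_comp_eq_csqrt_I_inv`).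
[folklore] -/
theorem etaSq_slash_S : etaSq ∣[(1 : ℤ)] ModularGroup.S = (-I : ℂ) • etaSq := by
  ext τ
  have he : η (-(↑τ)⁻¹) = (Complex.sqrt I)⁻¹ * (Complex.sqrt τ * η τ) := by
    simpa [neg_div] using eta_comp_eq_csqrt_I_inv τ.2
  have hτ : (τ : ℂ) ≠ 0 := τ.ne_zero
  suffices η (-(↑τ)⁻¹) ^ 2 * ((τ : ℂ) ^ (1 : ℤ))⁻¹ = -I * η τ ^ 2 by
    rw [SL_slash_apply, UpperHalfPlane.modular_S_smul]
    simpa [denom, ModularGroup.S, etaSq] using this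
  rw [he, mul_pow, mul_pow, inv_pow, csqrt_sq, csqrt_sq, zpow_one]
  field_simp
  rw [I_sq]
  ring

/-- `ζ¹² = 1` for `ζ = e^{πi/6}`. [folklore] -/
theorem cexp_pi_mul_I_div_six_pow_twelve : cexp (π * I / 6) ^ 12 = 1 := by
  rw [← Complex.exp_nat_mul, show ((12 : ℕ) : ℂ) * (π * I / 6) = 2 * π * I by push_cast; ring,
    Complex.exp_two_pi_mul_I]

/-- `η² |₁ T⁻¹ = ζ⁻¹ η²`. [folklore] -/
theorem etaSq_slash_T_inv :
    etaSq ∣[(1 : ℤ)] (ModularGroup.T⁻¹ : SL(2, ℤ)) = (cexp (π * I / 6))⁻¹ • etaSq := by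
  have h := congrArg (fun f : ℍ → ℂ ↦ f ∣[(1 : ℤ)] (ModularGroup.T⁻¹ : SL(2, ℤ))) etaSq_slash_T
  simp only [← SlashAction.slash_mul, mul_inv_cancel, SlashAction.slash_one, SL_smul_slash] at h
  calc etaSq ∣[(1 : ℤ)] (ModularGroup.T⁻¹ : SL(2, ℤ))
      = (cexp (π * I / 6))⁻¹ •
          (cexp (π * I / 6) • etaSq ∣[(1 : ℤ)] (ModularGroup.T⁻¹ : SL(2, ℤ))) := by
        rw [smul_smul, inv_mul_cancel₀ (Complex.exp_ne_zero _), one_smul]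
    _ = (cexp (π * I / 6))⁻¹ • etaSq := by rw [← h]

/-- `η² |₁ Tⁿ = ζⁿ η²` (`n ∈ ℤ`). [folklore] -/
theorem etaSq_slash_T_zpow (n : ℤ) :
    etaSq ∣[(1 : ℤ)] (ModularGroup.T ^ n) = (cexp (π * I / 6)) ^ n • etaSq := by
  induction n using Int.induction_on with
  | zero => simp
  | succ n ih =>
    rw [zpow_add_one, SlashAction.slash_mul, ih, SL_smul_slash, etaSq_slash_T, smul_smul,
      zpow_add_one₀ (Complex.exp_ne_zero _)]
  | pred n ih =>
    rw [show (-(n : ℤ) - 1) = -(n : ℤ) + (-1) by ring, zpow_add, zpow_neg_one,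
      SlashAction.slash_mul, ih, SL_smul_slash, etaSq_slash_T_inv, smul_smul,
      zpow_add₀ (Complex.exp_ne_zero _), zpow_neg_one]

/-- `η² |₁ Tⁿ = ζⁿ η²` (`n ∈ ℕ`). [folklore] -/
theorem etaSq_slash_T_pow (n : ℕ) :
    etaSq ∣[(1 : ℤ)] (ModularGroup.T ^ n) = (cexp (π * I / 6)) ^ n • etaSq := by
  exact_mod_cast etaSq_slash_T_zpow n

/-! ### Decay at the cusps -/

/-- `τ ↦ aτ + b` (`a > 0`, `b ∈ ℝ`) as a self-map of `ℍ`. [folklore] -/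
theorem im_affine_pos {a : ℝ} (ha : 0 < a) (b : ℝ) (τ : ℍ) : 0 < ((a : ℂ) * τ + b).im := by
  simpa using mul_pos ha τ.im_pos

/-- **`η(aτ + b)² → 0` as `Im τ → ∞`** (`a > 0`), because `|η|²⁴ = |Δ|` and `Δ` is a cusp form.
[folklore] -/
theorem tendsto_eta_sq_affine {a : ℝ} (ha : 0 < a) (b : ℝ) :
    Tendsto (fun τ : ℍ ↦ η ((a : ℂ) * τ + b) ^ 2) atImInfty (𝓝 0) := by
  let w : ℍ → ℍ := fun τ ↦ ⟨(a : ℂ) * τ + b, im_affine_pos ha b τ⟩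
  have hw : Tendsto w atImInfty atImInfty := by
    rw [atImInfty, tendsto_comap_iff]
    have : UpperHalfPlane.im ∘ w = fun τ ↦ a * τ.im := by
      funext τ
      change ((a : ℂ) * τ + b).im = a * τ.im
      simp
    rw [this]
    exact (tendsto_comap.const_mul_atTop ha)
  have hΔ : Tendsto (fun τ ↦ ModularForm.discriminant (w τ)) atImInfty (𝓝 0) :=
    discriminant_isZeroAtImInfty.comp hw
  rw [tendsto_zero_iff_norm_tendsto_zero] at hΔ ⊢
  have hrpow := hΔ.rpow_const (p := (12 : ℝ)⁻¹) (Or.inr (by positivity))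
  rw [Real.zero_rpow (by norm_num)] at hrpow
  refine hrpow.congr fun τ ↦ ?_
  rw [ModularForm.discriminant, norm_pow, norm_pow, show (24 : ℕ) = 2 * 12 by norm_num, pow_mul,
    show (12 : ℝ)⁻¹ = ((12 : ℕ) : ℝ)⁻¹ by norm_num,
    Real.pow_rpow_inv_natCast (by positivity) (by norm_num)]

/-- `η²(τ) → 0` as `Im τ → ∞`. [folklore] -/
theorem isZeroAtImInfty_etaSq : IsZeroAtImInfty etaSq :=
  (tendsto_eta_sq_affine one_pos 0).congr fun τ ↦ by simp [etaSq_apply]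

/-- Translation by `Tʲ` preserves decay at `∞`. [folklore] -/
theorem isZeroAtImInfty_slash_T_pow {g : ℍ → ℂ} (hg : IsZeroAtImInfty g) (k : ℤ) (j : ℕ) :
    IsZeroAtImInfty (g ∣[k] (ModularGroup.T ^ j)) := by
  have hT : Tendsto (fun τ : ℍ ↦ ((j : ℝ) +ᵥ τ)) atImInfty atImInfty := by
    rw [atImInfty, tendsto_comap_iff]
    have : UpperHalfPlane.im ∘ (fun τ : ℍ ↦ ((j : ℝ) +ᵥ τ)) = UpperHalfPlane.im := by
      funext τ; simp
    rw [this]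
    exact tendsto_comap
  rw [show ModularGroup.T ^ j = ModularGroup.T ^ (j : ℤ) from (zpow_natCast _ j).symm]
  have h := hg.comp hT
  refine h.congr fun τ ↦ ?_
  simp only [Function.comp_apply]
  rw [SL_slash_apply, modular_T_zpow_smul, ModularGroup.denom_apply]
  have hTj :
      ((ModularGroup.T : SL(2, ℤ)) : Matrix (Fin 2) (Fin 2) ℤ) ^ j = !![1, (j : ℤ); 0, 1] := by
    rw [← Matrix.SpecialLinearGroup.coe_pow, ← zpow_natCast, ModularGroup.coe_T_zpow]
  simp [hTj]

/-! ### Holomorphy of `η²` -/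

/-- `η²` is holomorphic on `ℍ` (Mathlib: `η` is differentiable on the upper half-plane).
[folklore] -/
theorem mdifferentiable_etaSq : MDiff etaSq := by
  rw [UpperHalfPlane.mdifferentiable_iff]
  refine .congr (f := fun z ↦ η z ^ 2) (fun z hz ↦
    ((differentiableAt_eta_of_mem_upperHalfPlaneSet hz).pow 2).differentiableWithinAt) fun z hz ↦ ?_
  simp [etaSq, ofComplex_apply_of_im_pos hz]

/-! ### The multiplier of `η²` in closed form -/

/-- The exponent in the multiplier of `η²`: for `γ = (a b; c d) ∈ SL₂(ℤ)`,
`η²|₁γ = ζ^{e(γ)} η²` with `ζ = e^{πi/6}` and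
`e(γ) ≡ (1 - c²)(bd + 3(c - 1)d + c + 3) + c(a + d - 3) (mod 12)`. [folklore] -/
def etaSqExp (a b c d : ℤ) : ℤ := (1 - c ^ 2) * (b * d + 3 * (c - 1) * d + c + 3) + c * (a + d - 3)

/-- The step identities of the exponent modulo `4`, checked on `(ℤ/4ℤ)⁴` by `decide`. [folklore] -/
theorem etaSqExp_steps_mod_four : ∀ a b c d : ZMod 4, a * d - b * c = 1 →
    ((1 - c ^ 2) * ((a + b) * (c + d) + 3 * (c - 1) * (c + d) + c + 3) + c * (a + (c + d) - 3) =
      (1 - c ^ 2) * (b * d + 3 * (c - 1) * d + c + 3) + c * (a + d - 3) + 1) ∧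
    ((1 - d ^ 2) * ((-a) * (-c) + 3 * (d - 1) * (-c) + d + 3) + d * (b + (-c) - 3) =
      (1 - c ^ 2) * (b * d + 3 * (c - 1) * d + c + 3) + c * (a + d - 3) + 9) := by
  decide

/-- The step identities of the exponent modulo `3`, checked on `(ℤ/3ℤ)⁴` by `decide`. [folklore] -/
theorem etaSqExp_steps_mod_three : ∀ a b c d : ZMod 3, a * d - b * c = 1 →
    ((1 - c ^ 2) * ((a + b) * (c + d) + 3 * (c - 1) * (c + d) + c + 3) + c * (a + (c + d) - 3) =
      (1 - c ^ 2) * (b * d + 3 * (c - 1) * d + c + 3) + c * (a + d - 3) + 1) ∧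
    ((1 - d ^ 2) * ((-a) * (-c) + 3 * (d - 1) * (-c) + d + 3) + d * (b + (-c) - 3) =
      (1 - c ^ 2) * (b * d + 3 * (c - 1) * d + c + 3) + c * (a + d - 3) + 9) := by
  decide

/-- `e(1) = 0`. [folklore] -/
theorem etaSqExp_one : etaSqExp 1 0 0 1 = 0 := by norm_num [etaSqExp]

/-- **Step `γ ↦ γT`**: `e(γT) ≡ e(γ) + 1 (mod 12)` for `γ ∈ SL₂(ℤ)` (reduction to `ℤ/4` and `ℤ/3`,
where it is a finite check). [folklore] -/
theorem twelve_dvd_etaSqExp_mul_T {a b c d : ℤ} (h : a * d - b * c = 1) :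
    (12 : ℤ) ∣ etaSqExp a (a + b) c (c + d) - (etaSqExp a b c d + 1) := by
  have h4 : (4 : ℤ) ∣ etaSqExp a (a + b) c (c + d) - (etaSqExp a b c d + 1) := by
    have hz : ((etaSqExp a (a + b) c (c + d) - (etaSqExp a b c d + 1) : ℤ) : ZMod 4) = 0 := by
      have := (etaSqExp_steps_mod_four a b c d
        (by exact_mod_cast congrArg (Int.cast : ℤ → ZMod 4) h)).1
      simp only [etaSqExp]
      push_cast
      linear_combination this
    exact_mod_cast (ZMod.intCast_zmod_eq_zero_iff_dvd _ 4).mp hz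
  have h3 : (3 : ℤ) ∣ etaSqExp a (a + b) c (c + d) - (etaSqExp a b c d + 1) := by
    have hz : ((etaSqExp a (a + b) c (c + d) - (etaSqExp a b c d + 1) : ℤ) : ZMod 3) = 0 := by
      have := (etaSqExp_steps_mod_three a b c d
        (by exact_mod_cast congrArg (Int.cast : ℤ → ZMod 3) h)).1
      simp only [etaSqExp]
      push_cast
      linear_combination this
    exact_mod_cast (ZMod.intCast_zmod_eq_zero_iff_dvd _ 3).mp hz
  omega

/-- **Step `γ ↦ γS`**: `e(γS) ≡ e(γ) + 9 (mod 12)` for `γ ∈ SL₂(ℤ)`. [folklore] -/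
theorem twelve_dvd_etaSqExp_mul_S {a b c d : ℤ} (h : a * d - b * c = 1) :
    (12 : ℤ) ∣ etaSqExp b (-a) d (-c) - (etaSqExp a b c d + 9) := by
  have h4 : (4 : ℤ) ∣ etaSqExp b (-a) d (-c) - (etaSqExp a b c d + 9) := by
    have hz : ((etaSqExp b (-a) d (-c) - (etaSqExp a b c d + 9) : ℤ) : ZMod 4) = 0 := by
      have := (etaSqExp_steps_mod_four a b c d
        (by exact_mod_cast congrArg (Int.cast : ℤ → ZMod 4) h)).2
      simp only [etaSqExp]
      push_cast
      linear_combination this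
    exact_mod_cast (ZMod.intCast_zmod_eq_zero_iff_dvd _ 4).mp hz
  have h3 : (3 : ℤ) ∣ etaSqExp b (-a) d (-c) - (etaSqExp a b c d + 9) := by
    have hz : ((etaSqExp b (-a) d (-c) - (etaSqExp a b c d + 9) : ℤ) : ZMod 3) = 0 := by
      have := (etaSqExp_steps_mod_three a b c d
        (by exact_mod_cast congrArg (Int.cast : ℤ → ZMod 3) h)).2
      simp only [etaSqExp]
      push_cast
      linear_combination this
    exact_mod_cast (ZMod.intCast_zmod_eq_zero_iff_dvd _ 3).mp hz
  omega

/-- `e^{πi(e + 12k)/6} = e^{πi e/6}`: the multiplier only depends on `e mod 12`. [folklore] -/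
theorem cexp_pi_mul_I_div_six_mul_eq {e e' : ℤ} (h : (12 : ℤ) ∣ e' - e) :
    cexp (π * I / 6 * e') = cexp (π * I / 6 * e) := by
  obtain ⟨k, hk⟩ := h
  rw [show (e' : ℂ) = e + 12 * k by exact_mod_cast (by linarith : e' = e + 12 * k), mul_add,
    Complex.exp_add, show (π * I / 6 * (12 * k) : ℂ) = k * (2 * π * I) by ring,
    Complex.exp_int_mul_two_pi_mul_I, mul_one]

/-- `ζ⁹ = -i`: `η²|₁S = -iη² = ζ⁹η²`. [folklore] -/
theorem cexp_pi_mul_I_div_six_mul_nine : cexp (π * I / 6 * 9) = -I := by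
  rw [show (π * I / 6 * 9 : ℂ) = π * I + (π / 2) * I by ring, Complex.exp_add, Complex.exp_pi_mul_I,
    Complex.exp_mul_I]
  simp [Complex.cos_pi_div_two, Complex.sin_pi_div_two]

/-- Entries of `γT`. [folklore] -/
theorem coe_mul_T (γ : SL(2, ℤ)) :
    (γ * ModularGroup.T) 0 0 = γ 0 0 ∧ (γ * ModularGroup.T) 0 1 = γ 0 0 + γ 0 1 ∧
      (γ * ModularGroup.T) 1 0 = γ 1 0 ∧ (γ * ModularGroup.T) 1 1 = γ 1 0 + γ 1 1 := by
  simp [Matrix.mul_apply, Fin.sum_univ_two, ModularGroup.coe_T]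

/-- Entries of `γS`. [folklore] -/
theorem coe_mul_S (γ : SL(2, ℤ)) :
    (γ * ModularGroup.S) 0 0 = γ 0 1 ∧ (γ * ModularGroup.S) 0 1 = -γ 0 0 ∧
      (γ * ModularGroup.S) 1 0 = γ 1 1 ∧ (γ * ModularGroup.S) 1 1 = -γ 1 0 := by
  simp [Matrix.mul_apply, Fin.sum_univ_two, ModularGroup.coe_S]

/-- **The multiplier system of `η²`**: for every `γ = (a b; c d) ∈ SL₂(ℤ)`,
`η² |₁ γ = ζ^{e(γ)} η²` with `ζ = e^{πi/6}` and
`e(γ) = (1 - c²)(bd + 3(c-1)d + c + 3) + c(a + d - 3) mod 12`. Equivalently `γ ↦ ζ^{e(γ)}` is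
the character of order `12` of `SL₂(ℤ)` (generating `Hom(SL₂(ℤ), ℂˣ) ≅ ℤ/12`) sending `T ↦ ζ`,
`S ↦ -i`; it factors through `SL₂(ℤ/12ℤ)`. Proved by induction over words in `S`, `T` from
`η²|T = ζη²`, `η²|S = -iη²` and the step congruences `e(γT) ≡ e(γ) + 1`, `e(γS) ≡ e(γ) + 9`,
themselves finite checks modulo `4` and `3`. [folklore] -/
theorem etaSq_slash_SL2 (γ : SL(2, ℤ)) :
    etaSq ∣[(1 : ℤ)] γ = cexp (π * I / 6 * etaSqExp (γ 0 0) (γ 0 1) (γ 1 0) (γ 1 1)) • etaSq := by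
  have hγ : γ ∈ Subgroup.closure ({ModularGroup.S, ModularGroup.T} : Set SL(2, ℤ)) := by
    rw [SpecialLinearGroup.SL2Z_generators]; trivial
  have hdet : ∀ x : SL(2, ℤ), x 0 0 * x 1 1 - x 0 1 * x 1 0 = 1 := fun x ↦ by
    have := Matrix.det_fin_two (x : Matrix (Fin 2) (Fin 2) ℤ)
    rw [x.det_coe] at this
    linarith
  induction hγ using Subgroup.closure_induction_right with
  | one =>
    rw [SlashAction.slash_one]
    simp [etaSqExp_one]
  | mul_right x hx y hy ih =>
    rcases hy with rfl | rfl
    · -- `y = S`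
      obtain ⟨h00, h01, h10, h11⟩ := coe_mul_S x
      rw [SlashAction.slash_mul, ih, SL_smul_slash, etaSq_slash_S, smul_smul, h00, h01, h10, h11,
        cexp_pi_mul_I_div_six_mul_eq (twelve_dvd_etaSqExp_mul_S (hdet x)), Int.cast_add, mul_add,
        Complex.exp_add, Int.cast_ofNat, cexp_pi_mul_I_div_six_mul_nine]
    · -- `y = T`
      obtain ⟨h00, h01, h10, h11⟩ := coe_mul_T x
      rw [SlashAction.slash_mul, ih, SL_smul_slash, etaSq_slash_T, smul_smul, h00, h01, h10, h11,
        cexp_pi_mul_I_div_six_mul_eq (twelve_dvd_etaSqExp_mul_T (hdet x)), Int.cast_add, mul_add,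
        Complex.exp_add, Int.cast_one, mul_one]
  | mul_inv_cancel x hx y hy ih =>
    rcases hy with rfl | rfl
    · -- `y = S`: write `x = z S`
      obtain ⟨z, rfl⟩ : ∃ z, x = z * ModularGroup.S :=
        ⟨x * ModularGroup.S⁻¹, by rw [inv_mul_cancel_right]⟩
      rw [mul_inv_cancel_right]
      obtain ⟨h00, h01, h10, h11⟩ := coe_mul_S z
      rw [h00, h01, h10, h11] at ih
      -- `η²|S⁻¹ = i η²`
      have hS : etaSq ∣[(1 : ℤ)] (ModularGroup.S⁻¹ : SL(2, ℤ)) = I • etaSq := by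
        have h := congrArg (fun f : ℍ → ℂ ↦ f ∣[(1 : ℤ)] (ModularGroup.S⁻¹ : SL(2, ℤ)))
          etaSq_slash_S
        simp only [← SlashAction.slash_mul, mul_inv_cancel, SlashAction.slash_one,
          SL_smul_slash] at h
        calc etaSq ∣[(1 : ℤ)] (ModularGroup.S⁻¹ : SL(2, ℤ))
            = I • ((-I) • etaSq ∣[(1 : ℤ)] (ModularGroup.S⁻¹ : SL(2, ℤ))) := by
              rw [smul_smul, show I * -I = 1 by rw [mul_neg, I_mul_I, neg_neg], one_smul]
          _ = I • etaSq := by rw [← h]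
      have h := congrArg (fun f : ℍ → ℂ ↦ f ∣[(1 : ℤ)] (ModularGroup.S⁻¹ : SL(2, ℤ))) ih
      simp only [← SlashAction.slash_mul, mul_inv_cancel_right, SL_smul_slash, hS, smul_smul] at h
      rw [h, cexp_pi_mul_I_div_six_mul_eq (twelve_dvd_etaSqExp_mul_S (hdet z)), Int.cast_add,
        mul_add, Complex.exp_add, Int.cast_ofNat, cexp_pi_mul_I_div_six_mul_nine, mul_assoc,
        show -I * I = 1 by rw [neg_mul, I_mul_I, neg_neg], mul_one]
    · -- `y = T`: write `x = z T`
      obtain ⟨z, rfl⟩ : ∃ z, x = z * ModularGroup.T :=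
        ⟨x * ModularGroup.T⁻¹, by rw [inv_mul_cancel_right]⟩
      rw [mul_inv_cancel_right]
      obtain ⟨h00, h01, h10, h11⟩ := coe_mul_T z
      rw [h00, h01, h10, h11] at ih
      have h := congrArg (fun f : ℍ → ℂ ↦ f ∣[(1 : ℤ)] (ModularGroup.T⁻¹ : SL(2, ℤ))) ih
      simp only [← SlashAction.slash_mul, mul_inv_cancel_right, SL_smul_slash, etaSq_slash_T_inv,
        smul_smul] at h
      rw [h, cexp_pi_mul_I_div_six_mul_eq (twelve_dvd_etaSqExp_mul_T (hdet z)), Int.cast_add,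
        mul_add, Complex.exp_add, Int.cast_one, mul_one, mul_assoc,
        mul_inv_cancel₀ (Complex.exp_ne_zero _), mul_one]

/-! ### The scaling matrices `D_a = diag(a, 1)` (`tpD`) and the translates `η(aτ)²` -/

/-- `det D_a = a > 0` for `D_a = tpD a = diag(a, 1)` (`HeckeOperatorsProofs.tpD`, the matrix
`β_∞` of Diamond–Shurman (5.2), reused here as the level-raising matrix). [folklore] -/
theorem det_tpD_pos (a : ℕ) [NeZero a] : 0 < (tpD a).det.val := by
  rw [det_tpD]; exact_mod_cast Nat.pos_of_ne_zero (NeZero.ne a)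

/-- `(η² |₁ D_a)(τ) = η(aτ)²` (`D_a = tpD a = diag(a, 1)`). [folklore] -/
theorem etaSq_slash_tpD_apply (a : ℕ) [NeZero a] (τ : ℍ) :
    (etaSq ∣[(1 : ℤ)] tpD a) τ = η (a * τ) ^ 2 := by
  rw [slash_tpD_apply, sub_self, zpow_zero, one_mul, etaSq_apply, coe_tpD_smul]

/-- `η(aτ)² ≠ 0`. [folklore] -/
theorem etaSq_slash_tpD_ne_zero (a : ℕ) [NeZero a] (τ : ℍ) :
    (etaSq ∣[(1 : ℤ)] tpD a) τ ≠ 0 := by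
  rw [etaSq_slash_tpD_apply]
  refine pow_ne_zero _ (eta_ne_zero ?_)
  have : 0 < (a : ℝ) := by exact_mod_cast Nat.pos_of_ne_zero (NeZero.ne a)
  simpa using mul_pos this τ.2

/-- **The translate `η(aτ)²` transforms under `g ∈ SL₂(ℤ)` with `a ∣ c` like `η²` under
`D_a g D_a⁻¹ = (p, aq; c/a, s)`**: `(η²|₁D_a)|₁g = e^{πi e(p, aq, c/a, s)/6} (η²|₁D_a)`.
[folklore] -/
theorem etaSq_slash_tpD_slash (a : ℕ) [NeZero a] {g : SL(2, ℤ)} {c' : ℤ}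
    (hc : g 1 0 = a * c') :
    (etaSq ∣[(1 : ℤ)] tpD a) ∣[(1 : ℤ)] (g : GL (Fin 2) ℝ) =
      cexp (π * I / 6 * etaSqExp (g 0 0) (a * g 0 1) c' (g 1 1)) •
        (etaSq ∣[(1 : ℤ)] tpD a) := by
  have hdet : g 0 0 * g 1 1 - g 0 1 * g 1 0 = 1 := by
    have := Matrix.det_fin_two (g : Matrix (Fin 2) (Fin 2) ℤ)
    rw [g.det_coe] at this
    linarith
  -- the conjugate `g_a = D_a g D_a⁻¹ ∈ SL₂(ℤ)`
  let ga : SL(2, ℤ) := ⟨!![g 0 0, a * g 0 1; c', g 1 1], by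
    rw [Matrix.det_fin_two_of]
    linear_combination hdet + g 0 1 * hc⟩
  have hconj : tpD a * (g : GL (Fin 2) ℝ) = (ga : GL (Fin 2) ℝ) * tpD a := by
    ext i j
    simp only [Units.val_mul, Matrix.mul_apply, Fin.sum_univ_two, val_tpD]
    rw [show ((g : SL(2, ℤ)) : GL (Fin 2) ℝ) = mapGL ℝ g from rfl,
      show ((ga : SL(2, ℤ)) : GL (Fin 2) ℝ) = mapGL ℝ ga from rfl]
    simp only [mapGL_coe_matrix, map_apply_coe, ga]
    have hc' : ((g 1 0 : ℤ) : ℝ) = a * c' := by exact_mod_cast hc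
    fin_cases i <;> fin_cases j <;> simp [hc'] <;> ring
  rw [← SlashAction.slash_mul, hconj, SlashAction.slash_mul, ← SL_slash, etaSq_slash_SL2,
    ModularForm.smul_slash, σ_eq_self (det_tpD_pos _)]
  rfl

/-- **All `SL₂(ℤ)`-translates of `η(aτ)²` vanish at `∞`**: for `γ ∈ SL₂(ℤ)`,
`(η²|₁D_a)|₁γ → 0` as `Im τ → ∞`. Indeed `D_aγ = γ'M` with `γ' ∈ SL₂(ℤ)` and
`M = (g m; 0 a/g)` upper triangular (`g = gcd(a γ₀₀, γ₁₀)`, Bezout), so the translate is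
`e^{iθ}(η²|₁M)`, and `(η²|₁M)(τ) = η((gτ + m)/(a/g))² · g/a → 0`. This gives the vanishing of
`η`-products at all cusps without locating the cusps. [folklore] -/
theorem isZeroAtImInfty_etaSq_slash_tpD_slash (a : ℕ) [NeZero a] (γ : SL(2, ℤ)) :
    IsZeroAtImInfty ((etaSq ∣[(1 : ℤ)] tpD a) ∣[(1 : ℤ)] (γ : GL (Fin 2) ℝ)) := by
  have ha : 0 < (a : ℤ) := by exact_mod_cast Nat.pos_of_ne_zero (NeZero.ne a)
  have hdet : γ 0 0 * γ 1 1 - γ 0 1 * γ 1 0 = 1 := by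
    have := Matrix.det_fin_two (γ : Matrix (Fin 2) (Fin 2) ℤ)
    rw [γ.det_coe] at this
    linarith
  -- first column `(p, r)` of `D_a γ` and its gcd `g`
  set p : ℤ := a * γ 0 0 with hp
  set r : ℤ := γ 1 0 with hr
  set q : ℤ := a * γ 0 1 with hq
  set s : ℤ := γ 1 1 with hs
  have hps : p * s - r * q = a := by
    simp only [hp, hr, hq, hs]; linear_combination (a : ℤ) * hdet
  set g : ℤ := (Int.gcd p r : ℤ) with hg
  have hg0 : g ≠ 0 := by
    intro h0
    have h0' : Int.gcd p r = 0 := by rw [hg] at h0; exact_mod_cast h0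
    rw [Int.gcd_eq_zero_iff] at h0'
    have : (a : ℤ) = 0 := by rw [← hps, h0'.1, h0'.2]; ring
    exact ha.ne' this
  have hgpos : 0 < g := lt_of_le_of_ne (by simp [hg]) (Ne.symm hg0)
  obtain ⟨p', hp'⟩ : g ∣ p := Int.gcd_dvd_left ..
  obtain ⟨r', hr'⟩ : g ∣ r := Int.gcd_dvd_right ..
  -- Bezout
  set x : ℤ := Int.gcdA p r
  set y : ℤ := Int.gcdB p r
  have hbez : p * x + r * y = g := (Int.gcd_eq_gcd_ab p r).symm
  have hbez' : p' * x + r' * y = 1 := by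
    have : g * (p' * x + r' * y - 1) = 0 := by
      linear_combination (hp' ▸ hr' ▸ hbez : (g * p') * x + (g * r') * y = g)
    rcases mul_eq_zero.mp this with h | h
    · exact absurd h hg0
    · linarith
  -- `a = g * a'` with `a' = p' s - r' q`
  set a' : ℤ := p' * s - r' * q with ha'
  have hga' : g * a' = a := by
    rw [ha', ← hps, hp', hr']; ring
  have ha'pos : 0 < a' := by
    rcases lt_trichotomy a' 0 with h | h | h
    · nlinarith
    · rw [h, mul_zero] at hga'; linarith
    · exact h
  -- `γ' ∈ SL₂(ℤ)` and `M`
  let γ' : SL(2, ℤ) := ⟨!![p', -y; r', x], by rw [Matrix.det_fin_two_of]; linear_combination hbez'⟩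
  set m : ℤ := x * q + y * s with hm
  have hdetM : Matrix.det !![(g : ℝ), (m : ℝ); 0, (a' : ℝ)] ≠ 0 := by
    rw [Matrix.det_fin_two_of]
    have : (g : ℝ) * a' ≠ 0 := by exact_mod_cast (mul_pos hgpos ha'pos).ne'
    simpa using this
  let M : GL (Fin 2) ℝ := Matrix.GeneralLinearGroup.mkOfDetNeZero _ hdetM
  have hMdet : 0 < M.det.val := by
    rw [Matrix.GeneralLinearGroup.val_det_apply]
    change 0 < Matrix.det !![(g : ℝ), (m : ℝ); 0, (a' : ℝ)]
    rw [Matrix.det_fin_two_of]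
    have : (0 : ℝ) < g * a' := by exact_mod_cast mul_pos hgpos ha'pos
    simpa using this
  have hσM : ∀ z, σ M z = z := fun z ↦ by simp only [σ, if_pos hMdet]; rfl
  -- `D_a γ = γ' M`
  have hdecomp : tpD a * (γ : GL (Fin 2) ℝ) = (γ' : GL (Fin 2) ℝ) * M := by
    ext i j
    simp only [Units.val_mul, Matrix.mul_apply, Fin.sum_univ_two, val_tpD]
    rw [show ((γ : SL(2, ℤ)) : GL (Fin 2) ℝ) = mapGL ℝ γ from rfl,
      show ((γ' : SL(2, ℤ)) : GL (Fin 2) ℝ) = mapGL ℝ γ' from rfl]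
    simp only [mapGL_coe_matrix, map_apply_coe, γ', M]
    have e00 : (a : ℝ) * (γ 0 0 : ℤ) = p' * g := by
      have : (p : ℝ) = g * p' := by exact_mod_cast hp'
      rw [show (a : ℝ) * (γ 0 0 : ℤ) = p by rw [hp]; push_cast; ring, this]; ring
    have e10 : ((γ 1 0 : ℤ) : ℝ) = r' * g := by
      have : (r : ℝ) = g * r' := by exact_mod_cast hr'
      rw [show ((γ 1 0 : ℤ) : ℝ) = r by rw [hr], this]; ring
    have e01 : (a : ℝ) * (γ 0 1 : ℤ) = p' * m + (-y) * a' := by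
      have h1 : (q : ℝ) = p' * m + (-y) * a' := by
        have : (q : ℤ) = p' * m + (-y) * a' := by
          rw [hm, ha']; linear_combination (-q) * hbez'
        exact_mod_cast this
      rw [show (a : ℝ) * (γ 0 1 : ℤ) = q by rw [hq]; push_cast; ring, h1]
    have e11 : ((γ 1 1 : ℤ) : ℝ) = r' * m + x * a' := by
      have : (s : ℤ) = r' * m + x * a' := by
        rw [hm, ha']; linear_combination (-s) * hbez'
      have h1 : (s : ℝ) = r' * m + x * a' := by exact_mod_cast this
      rw [show ((γ 1 1 : ℤ) : ℝ) = s by rw [hs], h1]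
    fin_cases i <;> fin_cases j <;>
      simp [Matrix.GeneralLinearGroup.mkOfDetNeZero, e00, e10, e01, e11]
  -- the translate by `M` decays
  have hM : IsZeroAtImInfty (etaSq ∣[(1 : ℤ)] M) := by
    have hslope : 0 < (g : ℝ) / a' := div_pos (by exact_mod_cast hgpos) (by exact_mod_cast ha'pos)
    have := (tendsto_eta_sq_affine hslope (m / a')).const_mul ((a' : ℂ)⁻¹)
    rw [mul_zero] at this
    refine this.congr fun τ ↦ ?_
    rw [slash_apply, hσM, etaSq_apply, sub_self, zpow_zero, mul_one, coe_smul_of_det_pos hMdet]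
    have hnum : num M τ = g * τ + m := by
      simp [num, M, Matrix.GeneralLinearGroup.mkOfDetNeZero]
    have hden : denom M τ = a' := by
      simp [denom, M, Matrix.GeneralLinearGroup.mkOfDetNeZero]
    have ha'C : (a' : ℂ) ≠ 0 := by exact_mod_cast ha'pos.ne'
    simp only [hnum, hden, zpow_neg, zpow_one]
    rw [mul_comm]
    congr 3
    push_cast
    field_simp
  rw [← SlashAction.slash_mul, hdecomp, SlashAction.slash_mul, ← SL_slash, etaSq_slash_SL2,
    ModularForm.smul_slash, hσM]
  exact hM.smul _

/-! ### Level `11`: the cusp form `η(τ)²η(11τ)²` -/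

/-- The exponent identity for `η(τ)²η(11τ)²` under `Γ₀(11)`, modulo `4` (`decide`). [folklore] -/
theorem etaProductEleven_exp_mod_four : ∀ p q k s : ZMod 4, p * s - q * (11 * k) = 1 →
    ((1 - (11 * k) ^ 2) * ((1 * q) * s + 3 * ((11 * k) - 1) * s + (11 * k) + 3) +
        (11 * k) * (p + s - 3)) +
      ((1 - (1 * k) ^ 2) * ((11 * q) * s + 3 * ((1 * k) - 1) * s + (1 * k) + 3) +
        (1 * k) * (p + s - 3)) = 0 := by
  decide

/-- The exponent identity for `η(τ)²η(11τ)²` under `Γ₀(11)`, modulo `3` (`decide`). [folklore] -/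
theorem etaProductEleven_exp_mod_three : ∀ p q k s : ZMod 3, p * s - q * (11 * k) = 1 →
    ((1 - (11 * k) ^ 2) * ((1 * q) * s + 3 * ((11 * k) - 1) * s + (11 * k) + 3) +
        (11 * k) * (p + s - 3)) +
      ((1 - (1 * k) ^ 2) * ((11 * q) * s + 3 * ((1 * k) - 1) * s + (1 * k) + 3) +
        (1 * k) * (p + s - 3)) = 0 := by
  decide

/-- **`e(γ_1) + e(γ_11) ≡ 0 (mod 12)` for `γ = (p q; 11k s) ∈ Γ₀(11)`**, where
`γ_a = D_aγD_a⁻¹`: the multipliers of `η(1τ)²` and `η(11τ)²` cancel. [folklore] -/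
theorem twelve_dvd_etaProductEleven_exp {p q k s : ℤ} (h : p * s - q * (11 * k) = 1) :
    (12 : ℤ) ∣ etaSqExp p (1 * q) (11 * k) s + etaSqExp p (11 * q) (1 * k) s := by
  have h4 : (4 : ℤ) ∣ etaSqExp p (1 * q) (11 * k) s + etaSqExp p (11 * q) (1 * k) s := by
    have hz : ((etaSqExp p (1 * q) (11 * k) s + etaSqExp p (11 * q) (1 * k) s : ℤ) :
        ZMod 4) = 0 := by
      have := etaProductEleven_exp_mod_four p q k s
        (by exact_mod_cast congrArg (Int.cast : ℤ → ZMod 4) h)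
      simp only [etaSqExp]
      push_cast
      linear_combination this
    exact_mod_cast (ZMod.intCast_zmod_eq_zero_iff_dvd _ 4).mp hz
  have h3 : (3 : ℤ) ∣ etaSqExp p (1 * q) (11 * k) s + etaSqExp p (11 * q) (1 * k) s := by
    have hz : ((etaSqExp p (1 * q) (11 * k) s + etaSqExp p (11 * q) (1 * k) s : ℤ) :
        ZMod 3) = 0 := by
      have := etaProductEleven_exp_mod_three p q k s
        (by exact_mod_cast congrArg (Int.cast : ℤ → ZMod 3) h)
      simp only [etaSqExp]
      push_cast
      linear_combination this
    exact_mod_cast (ZMod.intCast_zmod_eq_zero_iff_dvd _ 3).mp hz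
  omega

/-- `φ_11(τ) = η(τ)²η(11τ)²`, as `(η²|₁D_1)(η²|₁D_11)`. This is Diamond–Shurman's `φ₂ = η²η(11·)²`
(Prop. 3.2.2, `(k, N) = (2, 11)`). [cite: DiamondShurman2005, Prop. 3.2.2] -/
def etaProductEleven : ℍ → ℂ :=
  (etaSq ∣[(1 : ℤ)] tpD 1) * (etaSq ∣[(1 : ℤ)] tpD 11)

/-- `φ_11(τ) = η(τ)²η(11τ)²`. [folklore] -/
theorem etaProductEleven_apply (τ : ℍ) : etaProductEleven τ = η τ ^ 2 * η (11 * τ) ^ 2 := by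
  rw [etaProductEleven, Pi.mul_apply]
  simp only [etaSq_slash_tpD_apply]
  push_cast
  ring_nf

/-- **`φ_11 = η(τ)²η(11τ)²` is `Γ₀(11)`-invariant in weight `2`**: by the multiplier formula for
`η²`, `φ_11|₂γ = e^{πi(e(γ_1) + e(γ_11))/6} φ_11` and the exponent is `≡ 0 (mod 12)`. [folklore] -/
theorem etaProductEleven_slash_of_mem {γ : SL(2, ℤ)} (hγ : γ ∈ Gamma0 11) :
    etaProductEleven ∣[(2 : ℤ)] γ = etaProductEleven := by
  rw [Gamma0_mem] at hγ
  obtain ⟨k, hk⟩ := (ZMod.intCast_zmod_eq_zero_iff_dvd _ 11).mp hγ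
  have hdet : γ 0 0 * γ 1 1 - γ 0 1 * γ 1 0 = 1 := by
    have := Matrix.det_fin_two (γ : Matrix (Fin 2) (Fin 2) ℤ)
    rw [γ.det_coe] at this
    linarith
  have hA : γ 1 0 = ((1 : ℕ) : ℤ) * (11 * k) := by rw [hk]; push_cast; ring
  have hB : γ 1 0 = ((11 : ℕ) : ℤ) * (1 * k) := by rw [hk]; push_cast; ring
  have hmul := mul_slash_SL2 1 1 γ (etaSq ∣[(1 : ℤ)] tpD 1) (etaSq ∣[(1 : ℤ)] tpD 11)
  rw [show (1 : ℤ) + 1 = 2 by norm_num] at hmul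
  rw [etaProductEleven, hmul, SL_slash (f := etaSq ∣[(1 : ℤ)] tpD 1),
    SL_slash (f := etaSq ∣[(1 : ℤ)] tpD 11), etaSq_slash_tpD_slash 1 hA,
    etaSq_slash_tpD_slash 11 hB, smul_mul_smul_comm, ← Complex.exp_add, ← mul_add]
  simp only [Nat.cast_ofNat, Nat.cast_one]
  obtain ⟨m, hm⟩ :=
    twelve_dvd_etaProductEleven_exp (p := γ 0 0) (q := γ 0 1) (k := k) (s := γ 1 1)
    (by have h' := hdet; rw [hk] at h'; push_cast at h'; linarith)
  have hm' : (etaSqExp (γ 0 0) (1 * γ 0 1) (11 * k) (γ 1 1) : ℂ) +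
      (etaSqExp (γ 0 0) (11 * γ 0 1) (1 * k) (γ 1 1) : ℂ) = 12 * m := by exact_mod_cast hm
  rw [hm', show (π * I / 6 * (12 * (m : ℂ)) : ℂ) = m * (2 * π * I) by ring,
    Complex.exp_int_mul_two_pi_mul_I, one_smul]

/-- **The cusp form `η(τ)²η(11τ)² ∈ S₂(Γ₀(11))** (an `η`-quotient satisfying the classical
divisibility criteria; membership proved here from the multiplier of `η²` — invariance by the
closed formula, holomorphy from `η`, vanishing at all cusps by the Hermite decomposition of
`D_aγ`). [folklore] -/
def cuspFormEtaProductEleven : CuspForm (Gamma0 11) 2 where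
  toFun := etaProductEleven
  slash_action_eq' A hA := by
    obtain ⟨γ, hγ, rfl⟩ := hA
    exact etaProductEleven_slash_of_mem hγ
  holo' := (mdifferentiable_etaSq.slash _ _).mul (mdifferentiable_etaSq.slash _ _)
  zero_at_cusps' hc := by
    rw [Subgroup.IsArithmetic.isCusp_iff_isCusp_SL2Z] at hc
    rw [OnePoint.isZeroAt_iff_forall_SL2Z hc]
    intro γ _
    have hmul := mul_slash_SL2 1 1 γ (etaSq ∣[(1 : ℤ)] tpD 1) (etaSq ∣[(1 : ℤ)] tpD 11)
    rw [show (1 : ℤ) + 1 = 2 by norm_num, SL_slash, SL_slash, SL_slash] at hmul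
    change IsZeroAtImInfty (etaProductEleven ∣[(2 : ℤ)] (γ : GL (Fin 2) ℝ))
    rw [etaProductEleven, hmul]
    have h := (isZeroAtImInfty_etaSq_slash_tpD_slash 1 γ).mul
      (isZeroAtImInfty_etaSq_slash_tpD_slash 11 γ)
    simp only [mul_zero] at h
    exact h

/-- The underlying function of the cusp form `φ_11`. [folklore] -/
theorem coe_cuspFormEtaProductEleven :
    (cuspFormEtaProductEleven : ℍ → ℂ) = etaProductEleven := rfl

/-- `φ_11 ≠ 0`. [folklore] -/
theorem cuspFormEtaProductEleven_ne_zero : cuspFormEtaProductEleven ≠ 0 := by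
  intro h
  have := congrArg (fun f : CuspForm (Gamma0 11) 2 ↦ f UpperHalfPlane.I) h
  simp only [CuspForm.zero_apply] at this
  rw [show (cuspFormEtaProductEleven : ℍ → ℂ) UpperHalfPlane.I =
      etaProductEleven UpperHalfPlane.I from rfl,
    etaProductEleven, Pi.mul_apply] at this
  exact mul_ne_zero (etaSq_slash_tpD_ne_zero _ _) (etaSq_slash_tpD_ne_zero _ _) this

/-! ### Level `20`: the cusp form `η(2τ)²η(10τ)²` -/

/-- The exponent identity for `η(2τ)²η(10τ)²` under `Γ₀(20)`, modulo `4` (`decide`). [folklore] -/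
theorem etaProductTwenty_exp_mod_four : ∀ p q k s : ZMod 4, p * s - q * (20 * k) = 1 →
    ((1 - (10 * k) ^ 2) * ((2 * q) * s + 3 * ((10 * k) - 1) * s + (10 * k) + 3) +
        (10 * k) * (p + s - 3)) +
      ((1 - (2 * k) ^ 2) * ((10 * q) * s + 3 * ((2 * k) - 1) * s + (2 * k) + 3) +
        (2 * k) * (p + s - 3)) = 0 := by
  decide

/-- The exponent identity for `η(2τ)²η(10τ)²` under `Γ₀(20)`, modulo `3` (`decide`). [folklore] -/
theorem etaProductTwenty_exp_mod_three : ∀ p q k s : ZMod 3, p * s - q * (20 * k) = 1 →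
    ((1 - (10 * k) ^ 2) * ((2 * q) * s + 3 * ((10 * k) - 1) * s + (10 * k) + 3) +
        (10 * k) * (p + s - 3)) +
      ((1 - (2 * k) ^ 2) * ((10 * q) * s + 3 * ((2 * k) - 1) * s + (2 * k) + 3) +
        (2 * k) * (p + s - 3)) = 0 := by
  decide

/-- **`e(γ_2) + e(γ_10) ≡ 0 (mod 12)` for `γ = (p q; 20k s) ∈ Γ₀(20)`**, where
`γ_a = D_aγD_a⁻¹`: the multipliers of `η(2τ)²` and `η(10τ)²` cancel. [folklore] -/
theorem twelve_dvd_etaProductTwenty_exp {p q k s : ℤ} (h : p * s - q * (20 * k) = 1) :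
    (12 : ℤ) ∣ etaSqExp p (2 * q) (10 * k) s + etaSqExp p (10 * q) (2 * k) s := by
  have h4 : (4 : ℤ) ∣ etaSqExp p (2 * q) (10 * k) s + etaSqExp p (10 * q) (2 * k) s := by
    have hz : ((etaSqExp p (2 * q) (10 * k) s + etaSqExp p (10 * q) (2 * k) s : ℤ) :
        ZMod 4) = 0 := by
      have := etaProductTwenty_exp_mod_four p q k s
        (by exact_mod_cast congrArg (Int.cast : ℤ → ZMod 4) h)
      simp only [etaSqExp]
      push_cast
      linear_combination this
    exact_mod_cast (ZMod.intCast_zmod_eq_zero_iff_dvd _ 4).mp hz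
  have h3 : (3 : ℤ) ∣ etaSqExp p (2 * q) (10 * k) s + etaSqExp p (10 * q) (2 * k) s := by
    have hz : ((etaSqExp p (2 * q) (10 * k) s + etaSqExp p (10 * q) (2 * k) s : ℤ) :
        ZMod 3) = 0 := by
      have := etaProductTwenty_exp_mod_three p q k s
        (by exact_mod_cast congrArg (Int.cast : ℤ → ZMod 3) h)
      simp only [etaSqExp]
      push_cast
      linear_combination this
    exact_mod_cast (ZMod.intCast_zmod_eq_zero_iff_dvd _ 3).mp hz
  omega

/-- `φ_20(τ) = η(2τ)²η(10τ)²`, as `(η²|₁D_2)(η²|₁D_10)`. [folklore] -/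
def etaProductTwenty : ℍ → ℂ :=
  (etaSq ∣[(1 : ℤ)] tpD 2) * (etaSq ∣[(1 : ℤ)] tpD 10)

/-- `φ_20(τ) = η(2τ)²η(10τ)²`. [folklore] -/
theorem etaProductTwenty_apply (τ : ℍ) : etaProductTwenty τ = η (2 * τ) ^ 2 * η (10 * τ) ^ 2 := by
  rw [etaProductTwenty, Pi.mul_apply]
  simp only [etaSq_slash_tpD_apply]
  push_cast
  ring_nf

/-- **`φ_20 = η(2τ)²η(10τ)²` is `Γ₀(20)`-invariant in weight `2`**: by the multiplier formula for
`η²`, `φ_20|₂γ = e^{πi(e(γ_2) + e(γ_10))/6} φ_20` and the exponent is `≡ 0 (mod 12)`. [folklore] -/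
theorem etaProductTwenty_slash_of_mem {γ : SL(2, ℤ)} (hγ : γ ∈ Gamma0 20) :
    etaProductTwenty ∣[(2 : ℤ)] γ = etaProductTwenty := by
  rw [Gamma0_mem] at hγ
  obtain ⟨k, hk⟩ := (ZMod.intCast_zmod_eq_zero_iff_dvd _ 20).mp hγ
  have hdet : γ 0 0 * γ 1 1 - γ 0 1 * γ 1 0 = 1 := by
    have := Matrix.det_fin_two (γ : Matrix (Fin 2) (Fin 2) ℤ)
    rw [γ.det_coe] at this
    linarith
  have hA : γ 1 0 = ((2 : ℕ) : ℤ) * (10 * k) := by rw [hk]; push_cast; ring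
  have hB : γ 1 0 = ((10 : ℕ) : ℤ) * (2 * k) := by rw [hk]; push_cast; ring
  have hmul := mul_slash_SL2 1 1 γ (etaSq ∣[(1 : ℤ)] tpD 2) (etaSq ∣[(1 : ℤ)] tpD 10)
  rw [show (1 : ℤ) + 1 = 2 by norm_num] at hmul
  rw [etaProductTwenty, hmul, SL_slash (f := etaSq ∣[(1 : ℤ)] tpD 2),
    SL_slash (f := etaSq ∣[(1 : ℤ)] tpD 10), etaSq_slash_tpD_slash 2 hA,
    etaSq_slash_tpD_slash 10 hB, smul_mul_smul_comm, ← Complex.exp_add, ← mul_add]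
  simp only [Nat.cast_ofNat]
  obtain ⟨m, hm⟩ :=
    twelve_dvd_etaProductTwenty_exp (p := γ 0 0) (q := γ 0 1) (k := k) (s := γ 1 1)
    (by have h' := hdet; rw [hk] at h'; push_cast at h'; linarith)
  have hm' : (etaSqExp (γ 0 0) (2 * γ 0 1) (10 * k) (γ 1 1) : ℂ) +
      (etaSqExp (γ 0 0) (10 * γ 0 1) (2 * k) (γ 1 1) : ℂ) = 12 * m := by exact_mod_cast hm
  rw [hm', show (π * I / 6 * (12 * (m : ℂ)) : ℂ) = m * (2 * π * I) by ring,
    Complex.exp_int_mul_two_pi_mul_I, one_smul]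

/-- **The cusp form `η(2τ)²η(10τ)² ∈ S₂(Γ₀(20))`** (an `η`-quotient satisfying the classical
divisibility criteria; membership proved here from the multiplier of `η²` — invariance by the
closed formula, holomorphy from `η`, vanishing at all cusps by the Hermite decomposition of
`D_aγ`). [folklore] -/
def cuspFormEtaProductTwenty : CuspForm (Gamma0 20) 2 where
  toFun := etaProductTwenty
  slash_action_eq' A hA := by
    obtain ⟨γ, hγ, rfl⟩ := hA
    exact etaProductTwenty_slash_of_mem hγ
  holo' := (mdifferentiable_etaSq.slash _ _).mul (mdifferentiable_etaSq.slash _ _)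
  zero_at_cusps' hc := by
    rw [Subgroup.IsArithmetic.isCusp_iff_isCusp_SL2Z] at hc
    rw [OnePoint.isZeroAt_iff_forall_SL2Z hc]
    intro γ _
    have hmul := mul_slash_SL2 1 1 γ (etaSq ∣[(1 : ℤ)] tpD 2) (etaSq ∣[(1 : ℤ)] tpD 10)
    rw [show (1 : ℤ) + 1 = 2 by norm_num, SL_slash, SL_slash, SL_slash] at hmul
    change IsZeroAtImInfty (etaProductTwenty ∣[(2 : ℤ)] (γ : GL (Fin 2) ℝ))
    rw [etaProductTwenty, hmul]
    have h := (isZeroAtImInfty_etaSq_slash_tpD_slash 2 γ).mul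
      (isZeroAtImInfty_etaSq_slash_tpD_slash 10 γ)
    simp only [mul_zero] at h
    exact h

/-- The underlying function of the cusp form `φ_20`. [folklore] -/
theorem coe_cuspFormEtaProductTwenty :
    (cuspFormEtaProductTwenty : ℍ → ℂ) = etaProductTwenty := rfl

/-- `φ_20 ≠ 0`. [folklore] -/
theorem cuspFormEtaProductTwenty_ne_zero : cuspFormEtaProductTwenty ≠ 0 := by
  intro h
  have := congrArg (fun f : CuspForm (Gamma0 20) 2 ↦ f UpperHalfPlane.I) h
  simp only [CuspForm.zero_apply] at this
  rw [show (cuspFormEtaProductTwenty : ℍ → ℂ) UpperHalfPlane.I =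
      etaProductTwenty UpperHalfPlane.I from rfl,
    etaProductTwenty, Pi.mul_apply] at this
  exact mul_ne_zero (etaSq_slash_tpD_ne_zero _ _) (etaSq_slash_tpD_ne_zero _ _) this

/-! ### Level `27`: the cusp form `η(3τ)²η(9τ)²` -/

/-- The exponent identity for `η(3τ)²η(9τ)²` under `Γ₀(27)`, modulo `4` (`decide`). [folklore] -/
theorem etaProductTwentySeven_exp_mod_four : ∀ p q k s : ZMod 4, p * s - q * (27 * k) = 1 →
    ((1 - (9 * k) ^ 2) * ((3 * q) * s + 3 * ((9 * k) - 1) * s + (9 * k) + 3) +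
        (9 * k) * (p + s - 3)) +
      ((1 - (3 * k) ^ 2) * ((9 * q) * s + 3 * ((3 * k) - 1) * s + (3 * k) + 3) +
        (3 * k) * (p + s - 3)) = 0 := by
  decide

/-- The exponent identity for `η(3τ)²η(9τ)²` under `Γ₀(27)`, modulo `3` (`decide`). [folklore] -/
theorem etaProductTwentySeven_exp_mod_three : ∀ p q k s : ZMod 3, p * s - q * (27 * k) = 1 →
    ((1 - (9 * k) ^ 2) * ((3 * q) * s + 3 * ((9 * k) - 1) * s + (9 * k) + 3) +
        (9 * k) * (p + s - 3)) +
      ((1 - (3 * k) ^ 2) * ((9 * q) * s + 3 * ((3 * k) - 1) * s + (3 * k) + 3) +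
        (3 * k) * (p + s - 3)) = 0 := by
  decide

/-- **`e(γ_3) + e(γ_9) ≡ 0 (mod 12)` for `γ = (p q; 27k s) ∈ Γ₀(27)`**, where
`γ_a = D_aγD_a⁻¹`: the multipliers of `η(3τ)²` and `η(9τ)²` cancel. [folklore] -/
theorem twelve_dvd_etaProductTwentySeven_exp {p q k s : ℤ} (h : p * s - q * (27 * k) = 1) :
    (12 : ℤ) ∣ etaSqExp p (3 * q) (9 * k) s + etaSqExp p (9 * q) (3 * k) s := by
  have h4 : (4 : ℤ) ∣ etaSqExp p (3 * q) (9 * k) s + etaSqExp p (9 * q) (3 * k) s := by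
    have hz : ((etaSqExp p (3 * q) (9 * k) s + etaSqExp p (9 * q) (3 * k) s : ℤ) :
        ZMod 4) = 0 := by
      have := etaProductTwentySeven_exp_mod_four p q k s
        (by exact_mod_cast congrArg (Int.cast : ℤ → ZMod 4) h)
      simp only [etaSqExp]
      push_cast
      linear_combination this
    exact_mod_cast (ZMod.intCast_zmod_eq_zero_iff_dvd _ 4).mp hz
  have h3 : (3 : ℤ) ∣ etaSqExp p (3 * q) (9 * k) s + etaSqExp p (9 * q) (3 * k) s := by
    have hz : ((etaSqExp p (3 * q) (9 * k) s + etaSqExp p (9 * q) (3 * k) s : ℤ) :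
        ZMod 3) = 0 := by
      have := etaProductTwentySeven_exp_mod_three p q k s
        (by exact_mod_cast congrArg (Int.cast : ℤ → ZMod 3) h)
      simp only [etaSqExp]
      push_cast
      linear_combination this
    exact_mod_cast (ZMod.intCast_zmod_eq_zero_iff_dvd _ 3).mp hz
  omega

/-- `φ_27(τ) = η(3τ)²η(9τ)²`, as `(η²|₁D_3)(η²|₁D_9)`. [folklore] -/
def etaProductTwentySeven : ℍ → ℂ :=
  (etaSq ∣[(1 : ℤ)] tpD 3) * (etaSq ∣[(1 : ℤ)] tpD 9)

/-- `φ_27(τ) = η(3τ)²η(9τ)²`. [folklore] -/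
theorem etaProductTwentySeven_apply (τ : ℍ) :
    etaProductTwentySeven τ = η (3 * τ) ^ 2 * η (9 * τ) ^ 2 := by
  rw [etaProductTwentySeven, Pi.mul_apply]
  simp only [etaSq_slash_tpD_apply]
  push_cast
  ring_nf

/-- **`φ_27 = η(3τ)²η(9τ)²` is `Γ₀(27)`-invariant in weight `2`**: by the multiplier formula for
`η²`, `φ_27|₂γ = e^{πi(e(γ_3) + e(γ_9))/6} φ_27` and the exponent is `≡ 0 (mod 12)`. [folklore] -/
theorem etaProductTwentySeven_slash_of_mem {γ : SL(2, ℤ)} (hγ : γ ∈ Gamma0 27) :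
    etaProductTwentySeven ∣[(2 : ℤ)] γ = etaProductTwentySeven := by
  rw [Gamma0_mem] at hγ
  obtain ⟨k, hk⟩ := (ZMod.intCast_zmod_eq_zero_iff_dvd _ 27).mp hγ
  have hdet : γ 0 0 * γ 1 1 - γ 0 1 * γ 1 0 = 1 := by
    have := Matrix.det_fin_two (γ : Matrix (Fin 2) (Fin 2) ℤ)
    rw [γ.det_coe] at this
    linarith
  have hA : γ 1 0 = ((3 : ℕ) : ℤ) * (9 * k) := by rw [hk]; push_cast; ring
  have hB : γ 1 0 = ((9 : ℕ) : ℤ) * (3 * k) := by rw [hk]; push_cast; ring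
  have hmul := mul_slash_SL2 1 1 γ (etaSq ∣[(1 : ℤ)] tpD 3) (etaSq ∣[(1 : ℤ)] tpD 9)
  rw [show (1 : ℤ) + 1 = 2 by norm_num] at hmul
  rw [etaProductTwentySeven, hmul, SL_slash (f := etaSq ∣[(1 : ℤ)] tpD 3),
    SL_slash (f := etaSq ∣[(1 : ℤ)] tpD 9), etaSq_slash_tpD_slash 3 hA,
    etaSq_slash_tpD_slash 9 hB, smul_mul_smul_comm, ← Complex.exp_add, ← mul_add]
  simp only [Nat.cast_ofNat]
  obtain ⟨m, hm⟩ :=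
    twelve_dvd_etaProductTwentySeven_exp (p := γ 0 0) (q := γ 0 1) (k := k) (s := γ 1 1)
    (by have h' := hdet; rw [hk] at h'; push_cast at h'; linarith)
  have hm' : (etaSqExp (γ 0 0) (3 * γ 0 1) (9 * k) (γ 1 1) : ℂ) +
      (etaSqExp (γ 0 0) (9 * γ 0 1) (3 * k) (γ 1 1) : ℂ) = 12 * m := by exact_mod_cast hm
  rw [hm', show (π * I / 6 * (12 * (m : ℂ)) : ℂ) = m * (2 * π * I) by ring,
    Complex.exp_int_mul_two_pi_mul_I, one_smul]

/-- **The cusp form `η(3τ)²η(9τ)² ∈ S₂(Γ₀(27))`** (an `η`-quotient satisfying the classical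
divisibility criteria; membership proved here from the multiplier of `η²` — invariance by the
closed formula, holomorphy from `η`, vanishing at all cusps by the Hermite decomposition of
`D_aγ`). [folklore] -/
def cuspFormEtaProductTwentySeven : CuspForm (Gamma0 27) 2 where
  toFun := etaProductTwentySeven
  slash_action_eq' A hA := by
    obtain ⟨γ, hγ, rfl⟩ := hA
    exact etaProductTwentySeven_slash_of_mem hγ
  holo' := (mdifferentiable_etaSq.slash _ _).mul (mdifferentiable_etaSq.slash _ _)
  zero_at_cusps' hc := by
    rw [Subgroup.IsArithmetic.isCusp_iff_isCusp_SL2Z] at hc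
    rw [OnePoint.isZeroAt_iff_forall_SL2Z hc]
    intro γ _
    have hmul := mul_slash_SL2 1 1 γ (etaSq ∣[(1 : ℤ)] tpD 3) (etaSq ∣[(1 : ℤ)] tpD 9)
    rw [show (1 : ℤ) + 1 = 2 by norm_num, SL_slash, SL_slash, SL_slash] at hmul
    change IsZeroAtImInfty (etaProductTwentySeven ∣[(2 : ℤ)] (γ : GL (Fin 2) ℝ))
    rw [etaProductTwentySeven, hmul]
    have h := (isZeroAtImInfty_etaSq_slash_tpD_slash 3 γ).mul
      (isZeroAtImInfty_etaSq_slash_tpD_slash 9 γ)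
    simp only [mul_zero] at h
    exact h

/-- The underlying function of the cusp form `φ_27`. [folklore] -/
theorem coe_cuspFormEtaProductTwentySeven :
    (cuspFormEtaProductTwentySeven : ℍ → ℂ) = etaProductTwentySeven := rfl

/-- `φ_27 ≠ 0`. [folklore] -/
theorem cuspFormEtaProductTwentySeven_ne_zero : cuspFormEtaProductTwentySeven ≠ 0 := by
  intro h
  have := congrArg (fun f : CuspForm (Gamma0 27) 2 ↦ f UpperHalfPlane.I) h
  simp only [CuspForm.zero_apply] at this
  rw [show (cuspFormEtaProductTwentySeven : ℍ → ℂ) UpperHalfPlane.I =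
      etaProductTwentySeven UpperHalfPlane.I from rfl,
    etaProductTwentySeven, Pi.mul_apply] at this
  exact mul_ne_zero (etaSq_slash_tpD_ne_zero _ _) (etaSq_slash_tpD_ne_zero _ _) this

/-! ### Level `32`: the cusp form `η(4τ)²η(8τ)²` -/

/-- The exponent identity for `η(4τ)²η(8τ)²` under `Γ₀(32)`, modulo `4` (`decide`). [folklore] -/
theorem etaProductThirtyTwo_exp_mod_four : ∀ p q k s : ZMod 4, p * s - q * (32 * k) = 1 →
    ((1 - (8 * k) ^ 2) * ((4 * q) * s + 3 * ((8 * k) - 1) * s + (8 * k) + 3) +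
        (8 * k) * (p + s - 3)) +
      ((1 - (4 * k) ^ 2) * ((8 * q) * s + 3 * ((4 * k) - 1) * s + (4 * k) + 3) +
        (4 * k) * (p + s - 3)) = 0 := by
  decide

/-- The exponent identity for `η(4τ)²η(8τ)²` under `Γ₀(32)`, modulo `3` (`decide`). [folklore] -/
theorem etaProductThirtyTwo_exp_mod_three : ∀ p q k s : ZMod 3, p * s - q * (32 * k) = 1 →
    ((1 - (8 * k) ^ 2) * ((4 * q) * s + 3 * ((8 * k) - 1) * s + (8 * k) + 3) +
        (8 * k) * (p + s - 3)) +
      ((1 - (4 * k) ^ 2) * ((8 * q) * s + 3 * ((4 * k) - 1) * s + (4 * k) + 3) +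
        (4 * k) * (p + s - 3)) = 0 := by
  decide

/-- **`e(γ_4) + e(γ_8) ≡ 0 (mod 12)` for `γ = (p q; 32k s) ∈ Γ₀(32)`**, where
`γ_a = D_aγD_a⁻¹`: the multipliers of `η(4τ)²` and `η(8τ)²` cancel. [folklore] -/
theorem twelve_dvd_etaProductThirtyTwo_exp {p q k s : ℤ} (h : p * s - q * (32 * k) = 1) :
    (12 : ℤ) ∣ etaSqExp p (4 * q) (8 * k) s + etaSqExp p (8 * q) (4 * k) s := by
  have h4 : (4 : ℤ) ∣ etaSqExp p (4 * q) (8 * k) s + etaSqExp p (8 * q) (4 * k) s := by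
    have hz : ((etaSqExp p (4 * q) (8 * k) s + etaSqExp p (8 * q) (4 * k) s : ℤ) :
        ZMod 4) = 0 := by
      have := etaProductThirtyTwo_exp_mod_four p q k s
        (by exact_mod_cast congrArg (Int.cast : ℤ → ZMod 4) h)
      simp only [etaSqExp]
      push_cast
      linear_combination this
    exact_mod_cast (ZMod.intCast_zmod_eq_zero_iff_dvd _ 4).mp hz
  have h3 : (3 : ℤ) ∣ etaSqExp p (4 * q) (8 * k) s + etaSqExp p (8 * q) (4 * k) s := by
    have hz : ((etaSqExp p (4 * q) (8 * k) s + etaSqExp p (8 * q) (4 * k) s : ℤ) :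
        ZMod 3) = 0 := by
      have := etaProductThirtyTwo_exp_mod_three p q k s
        (by exact_mod_cast congrArg (Int.cast : ℤ → ZMod 3) h)
      simp only [etaSqExp]
      push_cast
      linear_combination this
    exact_mod_cast (ZMod.intCast_zmod_eq_zero_iff_dvd _ 3).mp hz
  omega

/-- `φ_32(τ) = η(4τ)²η(8τ)²`, as `(η²|₁D_4)(η²|₁D_8)`. [folklore] -/
def etaProductThirtyTwo : ℍ → ℂ :=
  (etaSq ∣[(1 : ℤ)] tpD 4) * (etaSq ∣[(1 : ℤ)] tpD 8)

/-- `φ_32(τ) = η(4τ)²η(8τ)²`. [folklore] -/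
theorem etaProductThirtyTwo_apply (τ : ℍ) :
    etaProductThirtyTwo τ = η (4 * τ) ^ 2 * η (8 * τ) ^ 2 := by
  rw [etaProductThirtyTwo, Pi.mul_apply]
  simp only [etaSq_slash_tpD_apply]
  push_cast
  ring_nf

/-- **`φ_32 = η(4τ)²η(8τ)²` is `Γ₀(32)`-invariant in weight `2`**: by the multiplier formula for
`η²`, `φ_32|₂γ = e^{πi(e(γ_4) + e(γ_8))/6} φ_32` and the exponent is `≡ 0 (mod 12)`. [folklore] -/
theorem etaProductThirtyTwo_slash_of_mem {γ : SL(2, ℤ)} (hγ : γ ∈ Gamma0 32) :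
    etaProductThirtyTwo ∣[(2 : ℤ)] γ = etaProductThirtyTwo := by
  rw [Gamma0_mem] at hγ
  obtain ⟨k, hk⟩ := (ZMod.intCast_zmod_eq_zero_iff_dvd _ 32).mp hγ
  have hdet : γ 0 0 * γ 1 1 - γ 0 1 * γ 1 0 = 1 := by
    have := Matrix.det_fin_two (γ : Matrix (Fin 2) (Fin 2) ℤ)
    rw [γ.det_coe] at this
    linarith
  have hA : γ 1 0 = ((4 : ℕ) : ℤ) * (8 * k) := by rw [hk]; push_cast; ring
  have hB : γ 1 0 = ((8 : ℕ) : ℤ) * (4 * k) := by rw [hk]; push_cast; ring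
  have hmul := mul_slash_SL2 1 1 γ (etaSq ∣[(1 : ℤ)] tpD 4) (etaSq ∣[(1 : ℤ)] tpD 8)
  rw [show (1 : ℤ) + 1 = 2 by norm_num] at hmul
  rw [etaProductThirtyTwo, hmul, SL_slash (f := etaSq ∣[(1 : ℤ)] tpD 4),
    SL_slash (f := etaSq ∣[(1 : ℤ)] tpD 8), etaSq_slash_tpD_slash 4 hA,
    etaSq_slash_tpD_slash 8 hB, smul_mul_smul_comm, ← Complex.exp_add, ← mul_add]
  simp only [Nat.cast_ofNat]
  obtain ⟨m, hm⟩ :=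
    twelve_dvd_etaProductThirtyTwo_exp (p := γ 0 0) (q := γ 0 1) (k := k) (s := γ 1 1)
    (by have h' := hdet; rw [hk] at h'; push_cast at h'; linarith)
  have hm' : (etaSqExp (γ 0 0) (4 * γ 0 1) (8 * k) (γ 1 1) : ℂ) +
      (etaSqExp (γ 0 0) (8 * γ 0 1) (4 * k) (γ 1 1) : ℂ) = 12 * m := by exact_mod_cast hm
  rw [hm', show (π * I / 6 * (12 * (m : ℂ)) : ℂ) = m * (2 * π * I) by ring,
    Complex.exp_int_mul_two_pi_mul_I, one_smul]

/-- **The cusp form `η(4τ)²η(8τ)² ∈ S₂(Γ₀(32))`** (an `η`-quotient satisfying the classical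
divisibility criteria; membership proved here from the multiplier of `η²` — invariance by the
closed formula, holomorphy from `η`, vanishing at all cusps by the Hermite decomposition of
`D_aγ`). [folklore] -/
def cuspFormEtaProductThirtyTwo : CuspForm (Gamma0 32) 2 where
  toFun := etaProductThirtyTwo
  slash_action_eq' A hA := by
    obtain ⟨γ, hγ, rfl⟩ := hA
    exact etaProductThirtyTwo_slash_of_mem hγ
  holo' := (mdifferentiable_etaSq.slash _ _).mul (mdifferentiable_etaSq.slash _ _)
  zero_at_cusps' hc := by
    rw [Subgroup.IsArithmetic.isCusp_iff_isCusp_SL2Z] at hc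
    rw [OnePoint.isZeroAt_iff_forall_SL2Z hc]
    intro γ _
    have hmul := mul_slash_SL2 1 1 γ (etaSq ∣[(1 : ℤ)] tpD 4) (etaSq ∣[(1 : ℤ)] tpD 8)
    rw [show (1 : ℤ) + 1 = 2 by norm_num, SL_slash, SL_slash, SL_slash] at hmul
    change IsZeroAtImInfty (etaProductThirtyTwo ∣[(2 : ℤ)] (γ : GL (Fin 2) ℝ))
    rw [etaProductThirtyTwo, hmul]
    have h := (isZeroAtImInfty_etaSq_slash_tpD_slash 4 γ).mul
      (isZeroAtImInfty_etaSq_slash_tpD_slash 8 γ)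
    simp only [mul_zero] at h
    exact h

/-- The underlying function of the cusp form `φ_32`. [folklore] -/
theorem coe_cuspFormEtaProductThirtyTwo :
    (cuspFormEtaProductThirtyTwo : ℍ → ℂ) = etaProductThirtyTwo := rfl

/-- `φ_32 ≠ 0`. [folklore] -/
theorem cuspFormEtaProductThirtyTwo_ne_zero : cuspFormEtaProductThirtyTwo ≠ 0 := by
  intro h
  have := congrArg (fun f : CuspForm (Gamma0 32) 2 ↦ f UpperHalfPlane.I) h
  simp only [CuspForm.zero_apply] at this
  rw [show (cuspFormEtaProductThirtyTwo : ℍ → ℂ) UpperHalfPlane.I =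
      etaProductThirtyTwo UpperHalfPlane.I from rfl,
    etaProductThirtyTwo, Pi.mul_apply] at this
  exact mul_ne_zero (etaSq_slash_tpD_ne_zero _ _) (etaSq_slash_tpD_ne_zero _ _) this

/-! ### Level `36`: the cusp form `η(6τ)²η(6τ)²` -/

/-- The exponent identity for `η(6τ)²η(6τ)²` under `Γ₀(36)`, modulo `4` (`decide`). [folklore] -/
theorem etaProductThirtySix_exp_mod_four : ∀ p q k s : ZMod 4, p * s - q * (36 * k) = 1 →
    ((1 - (6 * k) ^ 2) * ((6 * q) * s + 3 * ((6 * k) - 1) * s + (6 * k) + 3) +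
        (6 * k) * (p + s - 3)) +
      ((1 - (6 * k) ^ 2) * ((6 * q) * s + 3 * ((6 * k) - 1) * s + (6 * k) + 3) +
        (6 * k) * (p + s - 3)) = 0 := by
  decide

/-- The exponent identity for `η(6τ)²η(6τ)²` under `Γ₀(36)`, modulo `3` (`decide`). [folklore] -/
theorem etaProductThirtySix_exp_mod_three : ∀ p q k s : ZMod 3, p * s - q * (36 * k) = 1 →
    ((1 - (6 * k) ^ 2) * ((6 * q) * s + 3 * ((6 * k) - 1) * s + (6 * k) + 3) +
        (6 * k) * (p + s - 3)) +
      ((1 - (6 * k) ^ 2) * ((6 * q) * s + 3 * ((6 * k) - 1) * s + (6 * k) + 3) +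
        (6 * k) * (p + s - 3)) = 0 := by
  decide

/-- **`e(γ_6) + e(γ_6) ≡ 0 (mod 12)` for `γ = (p q; 36k s) ∈ Γ₀(36)`**, where
`γ_a = D_aγD_a⁻¹`: the multipliers of `η(6τ)²` and `η(6τ)²` cancel. [folklore] -/
theorem twelve_dvd_etaProductThirtySix_exp {p q k s : ℤ} (h : p * s - q * (36 * k) = 1) :
    (12 : ℤ) ∣ etaSqExp p (6 * q) (6 * k) s + etaSqExp p (6 * q) (6 * k) s := by
  have h4 : (4 : ℤ) ∣ etaSqExp p (6 * q) (6 * k) s + etaSqExp p (6 * q) (6 * k) s := by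
    have hz : ((etaSqExp p (6 * q) (6 * k) s + etaSqExp p (6 * q) (6 * k) s : ℤ) :
        ZMod 4) = 0 := by
      have := etaProductThirtySix_exp_mod_four p q k s
        (by exact_mod_cast congrArg (Int.cast : ℤ → ZMod 4) h)
      simp only [etaSqExp]
      push_cast
      linear_combination this
    exact_mod_cast (ZMod.intCast_zmod_eq_zero_iff_dvd _ 4).mp hz
  have h3 : (3 : ℤ) ∣ etaSqExp p (6 * q) (6 * k) s + etaSqExp p (6 * q) (6 * k) s := by
    have hz : ((etaSqExp p (6 * q) (6 * k) s + etaSqExp p (6 * q) (6 * k) s : ℤ) :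
        ZMod 3) = 0 := by
      have := etaProductThirtySix_exp_mod_three p q k s
        (by exact_mod_cast congrArg (Int.cast : ℤ → ZMod 3) h)
      simp only [etaSqExp]
      push_cast
      linear_combination this
    exact_mod_cast (ZMod.intCast_zmod_eq_zero_iff_dvd _ 3).mp hz
  omega

/-- `φ_36(τ) = η(6τ)²η(6τ)²`, as `(η²|₁D_6)(η²|₁D_6)`. [folklore] -/
def etaProductThirtySix : ℍ → ℂ :=
  (etaSq ∣[(1 : ℤ)] tpD 6) * (etaSq ∣[(1 : ℤ)] tpD 6)

/-- `φ_36(τ) = η(6τ)²η(6τ)²`. [folklore] -/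
theorem etaProductThirtySix_apply (τ : ℍ) :
    etaProductThirtySix τ = η (6 * τ) ^ 2 * η (6 * τ) ^ 2 := by
  rw [etaProductThirtySix, Pi.mul_apply]
  simp only [etaSq_slash_tpD_apply]
  push_cast
  ring_nf

/-- **`φ_36 = η(6τ)²η(6τ)²` is `Γ₀(36)`-invariant in weight `2`**: by the multiplier formula for
`η²`, `φ_36|₂γ = e^{πi(e(γ_6) + e(γ_6))/6} φ_36` and the exponent is `≡ 0 (mod 12)`. [folklore] -/
theorem etaProductThirtySix_slash_of_mem {γ : SL(2, ℤ)} (hγ : γ ∈ Gamma0 36) :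
    etaProductThirtySix ∣[(2 : ℤ)] γ = etaProductThirtySix := by
  rw [Gamma0_mem] at hγ
  obtain ⟨k, hk⟩ := (ZMod.intCast_zmod_eq_zero_iff_dvd _ 36).mp hγ
  have hdet : γ 0 0 * γ 1 1 - γ 0 1 * γ 1 0 = 1 := by
    have := Matrix.det_fin_two (γ : Matrix (Fin 2) (Fin 2) ℤ)
    rw [γ.det_coe] at this
    linarith
  have hA : γ 1 0 = ((6 : ℕ) : ℤ) * (6 * k) := by rw [hk]; push_cast; ring
  have hmul := mul_slash_SL2 1 1 γ (etaSq ∣[(1 : ℤ)] tpD 6) (etaSq ∣[(1 : ℤ)] tpD 6)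
  rw [show (1 : ℤ) + 1 = 2 by norm_num] at hmul
  rw [etaProductThirtySix, hmul, SL_slash (f := etaSq ∣[(1 : ℤ)] tpD 6),
    etaSq_slash_tpD_slash 6 hA, smul_mul_smul_comm, ← Complex.exp_add, ← mul_add]
  simp only [Nat.cast_ofNat]
  obtain ⟨m, hm⟩ :=
    twelve_dvd_etaProductThirtySix_exp (p := γ 0 0) (q := γ 0 1) (k := k) (s := γ 1 1)
    (by have h' := hdet; rw [hk] at h'; push_cast at h'; linarith)
  have hm' : (etaSqExp (γ 0 0) (6 * γ 0 1) (6 * k) (γ 1 1) : ℂ) +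
      (etaSqExp (γ 0 0) (6 * γ 0 1) (6 * k) (γ 1 1) : ℂ) = 12 * m := by exact_mod_cast hm
  rw [hm', show (π * I / 6 * (12 * (m : ℂ)) : ℂ) = m * (2 * π * I) by ring,
    Complex.exp_int_mul_two_pi_mul_I, one_smul]

/-- **The cusp form `η(6τ)²η(6τ)² ∈ S₂(Γ₀(36))`** (an `η`-quotient satisfying the classical
divisibility criteria; membership proved here from the multiplier of `η²` — invariance by the
closed formula, holomorphy from `η`, vanishing at all cusps by the Hermite decomposition of
`D_aγ`). [folklore] -/
def cuspFormEtaProductThirtySix : CuspForm (Gamma0 36) 2 where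
  toFun := etaProductThirtySix
  slash_action_eq' A hA := by
    obtain ⟨γ, hγ, rfl⟩ := hA
    exact etaProductThirtySix_slash_of_mem hγ
  holo' := (mdifferentiable_etaSq.slash _ _).mul (mdifferentiable_etaSq.slash _ _)
  zero_at_cusps' hc := by
    rw [Subgroup.IsArithmetic.isCusp_iff_isCusp_SL2Z] at hc
    rw [OnePoint.isZeroAt_iff_forall_SL2Z hc]
    intro γ _
    have hmul := mul_slash_SL2 1 1 γ (etaSq ∣[(1 : ℤ)] tpD 6) (etaSq ∣[(1 : ℤ)] tpD 6)
    rw [show (1 : ℤ) + 1 = 2 by norm_num, SL_slash, SL_slash] at hmul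
    change IsZeroAtImInfty (etaProductThirtySix ∣[(2 : ℤ)] (γ : GL (Fin 2) ℝ))
    rw [etaProductThirtySix, hmul]
    have h := (isZeroAtImInfty_etaSq_slash_tpD_slash 6 γ).mul
      (isZeroAtImInfty_etaSq_slash_tpD_slash 6 γ)
    simp only [mul_zero] at h
    exact h

/-- The underlying function of the cusp form `φ_36`. [folklore] -/
theorem coe_cuspFormEtaProductThirtySix :
    (cuspFormEtaProductThirtySix : ℍ → ℂ) = etaProductThirtySix := rfl

/-- `φ_36 ≠ 0`. [folklore] -/
theorem cuspFormEtaProductThirtySix_ne_zero : cuspFormEtaProductThirtySix ≠ 0 := by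
  intro h
  have := congrArg (fun f : CuspForm (Gamma0 36) 2 ↦ f UpperHalfPlane.I) h
  simp only [CuspForm.zero_apply] at this
  rw [show (cuspFormEtaProductThirtySix : ℍ → ℂ) UpperHalfPlane.I =
      etaProductThirtySix UpperHalfPlane.I from rfl,
    etaProductThirtySix, Pi.mul_apply] at this
  exact mul_ne_zero (etaSq_slash_tpD_ne_zero _ _) (etaSq_slash_tpD_ne_zero _ _) this

/-! ### `dim S₂(Γ₀(N)) = 1 = g(X₀(N))` for `N = 11, 20, 27, 32, 36` -/

section Finrank

variable {N : ℕ} [NeZero N]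

/-- From a nonzero cusp form and the Sturm bound `dim S₂(Γ₀(N)) ≤ 1 = g(X₀(N))`:
`dim S₂(Γ₀(N)) = 1`, the fact `finrank_cuspForm_two_eq_genusX0 N`, and `S₂(Γ₀(N)) = ℂφ`.
[folklore] -/
theorem finrank_cuspForm_two_eq_one_of_ne_zero
    (hN : N ∈ ({11, 14, 15, 20, 24, 27, 32, 36} : Finset ℕ))
    {φ : CuspForm (Gamma0 N) 2} (hφ : φ ≠ 0) :
    Module.finrank ℂ (CuspForm (Gamma0 N) 2) = 1 ∧ finrank_cuspForm_two_eq_genusX0 N ∧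
      ∀ f : CuspForm (Gamma0 N) 2, ∃ c : ℂ, c • φ = f := by
  have hfd : FiniteDimensional ℂ (CuspForm (Gamma0 N) 2) := finiteDimensional_cuspForm_gamma0 N 2
  obtain ⟨hle, hg⟩ := finrank_cuspForm_two_le_genusX0_of_mem hN
  rw [hg] at hle
  have h1 : Module.finrank ℂ (CuspForm (Gamma0 N) 2) = 1 := by
    refine le_antisymm hle ?_
    rw [Nat.one_le_iff_ne_zero, Ne, finrank_zero_iff_forall_zero, not_forall]
    exact ⟨φ, hφ⟩
  refine ⟨h1, ?_, fun f ↦ (finrank_eq_one_iff_of_nonzero' φ hφ).mp h1 f⟩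
  unfold finrank_cuspForm_two_eq_genusX0
  rw [h1, hg]

end Finrank

/-- **`dim S₂(Γ₀(11)) = g(X₀(11)) = 1`**, the level-`11` instance of the named fact
`finrank_cuspForm_two_eq_genusX0` (Diamond–Shurman Thm. 3.5.1), unconditionally; and
`S₂(Γ₀(11)) = ℂ η(τ)²η(11τ)²` (Prop. 3.2.2(b)). [cite: DiamondShurman2005, Prop. 3.2.2] -/
theorem finrank_cuspForm_two_eq_genusX0_eleven :
    finrank_cuspForm_two_eq_genusX0 11 ∧ Module.finrank ℂ (CuspForm (Gamma0 11) 2) = 1 ∧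
      ∀ f : CuspForm (Gamma0 11) 2, ∃ c : ℂ, c • cuspFormEtaProductEleven = f := by
  obtain ⟨h1, h2, h3⟩ := finrank_cuspForm_two_eq_one_of_ne_zero (N := 11) (by decide)
    cuspFormEtaProductEleven_ne_zero
  exact ⟨h2, h1, h3⟩

/-- **`dim S₂(Γ₀(20)) = g(X₀(20)) = 1`** and `S₂(Γ₀(20)) = ℂ η(2τ)²η(10τ)²`.
[cite: DiamondShurman2005, Thm. 3.5.1] -/
theorem finrank_cuspForm_two_eq_genusX0_twenty :
    finrank_cuspForm_two_eq_genusX0 20 ∧ Module.finrank ℂ (CuspForm (Gamma0 20) 2) = 1 ∧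
      ∀ f : CuspForm (Gamma0 20) 2, ∃ c : ℂ, c • cuspFormEtaProductTwenty = f := by
  obtain ⟨h1, h2, h3⟩ := finrank_cuspForm_two_eq_one_of_ne_zero (N := 20) (by decide)
    cuspFormEtaProductTwenty_ne_zero
  exact ⟨h2, h1, h3⟩

/-- **`dim S₂(Γ₀(27)) = g(X₀(27)) = 1`** and `S₂(Γ₀(27)) = ℂ η(3τ)²η(9τ)²`.
[cite: DiamondShurman2005, Thm. 3.5.1] -/
theorem finrank_cuspForm_two_eq_genusX0_twentySeven :
    finrank_cuspForm_two_eq_genusX0 27 ∧ Module.finrank ℂ (CuspForm (Gamma0 27) 2) = 1 ∧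
      ∀ f : CuspForm (Gamma0 27) 2, ∃ c : ℂ, c • cuspFormEtaProductTwentySeven = f := by
  obtain ⟨h1, h2, h3⟩ := finrank_cuspForm_two_eq_one_of_ne_zero (N := 27) (by decide)
    cuspFormEtaProductTwentySeven_ne_zero
  exact ⟨h2, h1, h3⟩

/-- **`dim S₂(Γ₀(32)) = g(X₀(32)) = 1`** and `S₂(Γ₀(32)) = ℂ η(4τ)²η(8τ)²`.
[cite: DiamondShurman2005, Thm. 3.5.1] -/
theorem finrank_cuspForm_two_eq_genusX0_thirtyTwo :
    finrank_cuspForm_two_eq_genusX0 32 ∧ Module.finrank ℂ (CuspForm (Gamma0 32) 2) = 1 ∧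
      ∀ f : CuspForm (Gamma0 32) 2, ∃ c : ℂ, c • cuspFormEtaProductThirtyTwo = f := by
  obtain ⟨h1, h2, h3⟩ := finrank_cuspForm_two_eq_one_of_ne_zero (N := 32) (by decide)
    cuspFormEtaProductThirtyTwo_ne_zero
  exact ⟨h2, h1, h3⟩

/-- **`dim S₂(Γ₀(36)) = g(X₀(36)) = 1`** and `S₂(Γ₀(36)) = ℂ η(6τ)⁴`.
[cite: DiamondShurman2005, Thm. 3.5.1] -/
theorem finrank_cuspForm_two_eq_genusX0_thirtySix :
    finrank_cuspForm_two_eq_genusX0 36 ∧ Module.finrank ℂ (CuspForm (Gamma0 36) 2) = 1 ∧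
      ∀ f : CuspForm (Gamma0 36) 2, ∃ c : ℂ, c • cuspFormEtaProductThirtySix = f := by
  obtain ⟨h1, h2, h3⟩ := finrank_cuspForm_two_eq_one_of_ne_zero (N := 36) (by decide)
    cuspFormEtaProductThirtySix_ne_zero
  exact ⟨h2, h1, h3⟩

/-- **`dim S₂(Γ₀(N)) = g(X₀(N))` for all `N ≤ 12`**: the named fact
`finrank_cuspForm_two_eq_genusX0 N` holds unconditionally for `1 ≤ N ≤ 12`
(`ModularCurveProofs` for `N = 1`, `ModularCurveSturmProofs` for the genus-zero levels, this file
for `N = 11`). [cite: DiamondShurman2005, Thm. 3.5.1] -/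
theorem finrank_cuspForm_two_eq_genusX0_of_le_twelve {N : ℕ} [NeZero N] (hN : N ≤ 12) :
    finrank_cuspForm_two_eq_genusX0 N := by
  have hN0 : N ≠ 0 := NeZero.ne N
  rcases Nat.lt_or_ge N 2 with h | h
  · obtain rfl : N = 1 := by omega
    exact finrank_cuspForm_two_eq_genusX0_one
  · by_cases h11 : N = 11
    · subst h11
      exact finrank_cuspForm_two_eq_genusX0_eleven.1
    · exact finrank_cuspForm_two_eq_genusX0_of_mem (by interval_cases N <;> simp_all)

end Literature.NumberTheory.EllipticCurves.ModularForms
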